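import Mathlib.NumberTheory.Padics.RingHoms
import Mathlib.NumberTheory.NumberField.Units.DirichletTheorem
import Mathlib.GroupTheory.OrderOfElement
import Literature.NumberTheory.GaloisRepresentations.UnitIdeles
import HarnessLib

/-!
# Characters of the idele class group from characters of the local units (proofs only)

Topic `NumberTheory/EllipticCurves` (Iwasawa theory of `ℤ_p`-extensions: the `K`-side of
`Literature.NumberTheory.EllipticCurves.ZpExtension.exists_isAnticyclotomic`); namespace `Literature`.  No new definitions.

Let `K` be a number field of unit rank `0` (`K = ℚ` or imaginary quadratic) and `p` a prime.
Washington's proof of the `ℤ_p`-rank theorem (*Introduction to Cyclotomic Fields*, §13.1,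
Thm. 13.4) computes `Gal(K̃/K)` from the exact sequence `Ē → ∏_{𝔭∣p} U_{𝔭} → Gal(F/H) → 0` of
global class field theory together with the finiteness of `Gal(H/K) ≅ Cl_K`.  This file proves
the idelic half of that argument, i.e. everything except class field theory:

* `Literature.NumberTheory.EllipticCurves.isOfFinOrder_units_of_rank_eq_zero` : in unit rank `0` every unit of `𝓞_K` has finite order
  (Dirichlet);
* `Literature.NumberTheory.EllipticCurves.exists_idelicCharacters` : given, for each `v ∣ p`, `n_v` continuous characters
  `𝒪_vˣ → ℤ_p` with joint image `⊇ p^{N_v} ℤ_p^{n_v}`, `p^{n_v} = #(𝒪_v/p)` (hypothesis `hloc`, the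
  shape of `Literature.NumberTheory.GaloisRepresentations.OneUnits.exists_continuousMonoidHom_forall_exists` for `A = 𝒪_v`), and the
  inequality `[K:ℚ] ≤ ∑_{v∣p} n_v` (hypothesis `hsum`) — both supplied by the sibling
  `GaloisRepresentations/LocalOneUnitsNumberFieldProofs.lean` — there are `m ≥ [K:ℚ]` continuous
  characters `χ_j : 𝕀_K → ℤ_p` **trivial on `Kˣ`** whose joint image contains `p^M ℤ_p^m`.
  Construction: `x^h = k · u` (`k ∈ Kˣ`, `u ∈ 𝕌_K`, `h` the class number,
  `exists_unitOrd_pow_card_classGroup_eq_zero`), unique up to a global unit of finite order;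
  `χ(x) = (φ_{v,i}(u_v))`.

The passage from these `χ_j` (characters of `C_K`) to characters of `Γ_K` is the global
reciprocity law (`GlobalReciprocity.lean`), carried out in
`ZpExtensionGlobalReciprocityProofs.lean`.

## References

* L. C. Washington, *Introduction to Cyclotomic Fields*, 2nd ed., GTM 83, §13.1, Thm. 13.4 and
  its proof (p. 265–266).
* S. Lang, *Cyclotomic Fields I and II*, GTM 121, Ch. 5 §5, Thm. 5.1–5.2.
* J. Neukirch, *Algebraic Number Theory*, Ch. VI §1, Prop. (1.3)–(1.4).
-/

noncomputable section

open NumberField IsDedekindDomain Topology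
open scoped RestrictedProduct

namespace Literature.NumberTheory.EllipticCurves

universe u

/-! ### From local characters to characters of the idele class group -/

section Main

variable {K : Type u} [Field K] [NumberField K]

/-- In a number field of unit rank `0` (`K = ℚ` or imaginary quadratic) every unit has finite
order (Dirichlet: `𝓞_Kˣ = μ_K × ℤ^{r₁+r₂-1}`).  Ref: Washington, *Introduction to Cyclotomic
Fields*, §13.1 (Leopoldt's conjecture is trivial for unit rank `0`). [folklore] -/
theorem isOfFinOrder_units_of_rank_eq_zero (h0 : NumberField.Units.rank K = 0) (ε : (𝓞 K)ˣ) :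
    IsOfFinOrder ε := by
  obtain ⟨⟨ζ, e⟩, hζ, -⟩ := NumberField.Units.exist_unique_eq_mul_prod K ε
  have hempty : (Finset.univ : Finset (Fin (NumberField.Units.rank K))) = ∅ := by
    rw [Finset.univ_eq_empty_iff, h0]
    exact Fin.isEmpty'
  rw [hempty, Finset.prod_empty, mul_one] at hζ
  rw [hζ]
  change IsOfFinOrder (ζ : (𝓞 K)ˣ)
  have hmem : (ζ : (𝓞 K)ˣ) ∈ CommGroup.torsion (𝓞 K)ˣ := ζ.2
  exact (CommGroup.mem_torsion _).1 hmem


open GaloisRepresentations.unitIdeles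

/-- **The idele with prescribed unit components.**  Given local units `u_w ∈ 𝒪_wˣ` at the
places `w` of a finite set `T`, the idele `x₀ = ∏_{w ∈ T} (…, 1, u_w, 1, …)` is a unit idele with
`(x₀)_w = u_w` for `w ∈ T`, `(x₀)_v = 1` for `v ∉ T` and trivial archimedean part.
Ref: Neukirch, *Algebraic Number Theory*, Ch. VI §1. [folklore] -/
theorem exists_mem_unitIdeles_localUnit_eq (T : Finset (HeightOneSpectrum (𝓞 K)))
    (u : ∀ w : T, (w.1.adicCompletionIntegers K)ˣ) :
    ∃ (x₀ : GaloisRepresentations.ideleGroup K) (hx₀ : x₀ ∈ GaloisRepresentations.unitIdeles K),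
      (∀ w : T, localUnit w.1 ⟨x₀, hx₀⟩ = u w) ∧ (x₀ : AdeleRing (𝓞 K) K).1 = 1 ∧
      ∀ v : HeightOneSpectrum (𝓞 K), v ∉ T → (x₀ : AdeleRing (𝓞 K) K).2 v = 1 := by
  classical
  -- the idele with components `u_w` at `w ∈ T` and `1` elsewhere
  let ι : ∀ w : T, (w.1.adicCompletionIntegers K)ˣ →* GaloisRepresentations.ideleGroup K := fun w =>
    (GaloisRepresentations.localUnits w.1).comp (Units.map ((w.1.adicCompletionIntegers K).subtype : _ →* _))
  have hι_comp : ∀ (w : T) (z : (w.1.adicCompletionIntegers K)ˣ) (v : HeightOneSpectrum (𝓞 K)),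
      ((ι w z : GaloisRepresentations.ideleGroup K) : AdeleRing (𝓞 K) K).2 v =
        GaloisRepresentations.finiteAdeleSingle w.1 ((z : w.1.adicCompletionIntegers K) : w.1.adicCompletion K) v :=
    fun w z v => rfl
  let x₀ : GaloisRepresentations.ideleGroup K := ∏ w : T, ι w (u w)
  have hx₀_comp : ∀ v : HeightOneSpectrum (𝓞 K), (x₀ : AdeleRing (𝓞 K) K).2 v =
      ∏ w : T, GaloisRepresentations.finiteAdeleSingle w.1 ((u w : w.1.adicCompletionIntegers K) : w.1.adicCompletion K) v := by
    intro v
    rw [← GaloisRepresentations.ideleGroup.finComp_apply, map_prod]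
    exact Finset.prod_congr rfl fun w _ => hι_comp w (u w) v
  have hx₀_T : ∀ w₀ : T, (x₀ : AdeleRing (𝓞 K) K).2 w₀.1 =
      ((u w₀ : w₀.1.adicCompletionIntegers K) : w₀.1.adicCompletion K) := by
    intro w₀
    rw [hx₀_comp, Finset.prod_eq_single w₀]
    · exact GaloisRepresentations.finiteAdeleSingle_apply_self _ _
    · intro w _ hw
      exact GaloisRepresentations.finiteAdeleSingle_apply_of_ne _ fun h => hw (Subtype.ext h.symm)
    · intro h; exact absurd (Finset.mem_univ w₀) h
  have hx₀_nT : ∀ v : HeightOneSpectrum (𝓞 K), v ∉ T → (x₀ : AdeleRing (𝓞 K) K).2 v = 1 := by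
    intro v hv
    rw [hx₀_comp]
    refine Finset.prod_eq_one fun w _ => GaloisRepresentations.finiteAdeleSingle_apply_of_ne _ fun h => hv ?_
    rw [h]; exact w.2
  have hx₀_mem : x₀ ∈ GaloisRepresentations.unitIdeles K := by
    intro v
    by_cases hv : v ∈ T
    · have := hx₀_T ⟨v, hv⟩
      change (x₀ : AdeleRing (𝓞 K) K).2 v = _ at this
      rw [this]
      exact (Valuation.Integers.isUnit_iff_valuation_eq_one
        (Valuation.valuationSubring.integers _)).1 (Units.isUnit _)
    · rw [hx₀_nT v hv, map_one]
  have hx₀_loc : ∀ w : T, localUnit w.1 ⟨x₀, hx₀_mem⟩ = u w := fun w =>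
    Units.ext (Subtype.ext (by rw [coe_localUnit]; exact hx₀_T w))
  have hx₀_fst : (x₀ : AdeleRing (𝓞 K) K).1 = 1 := by
    rw [← GaloisRepresentations.ideleGroup.infComp_apply, map_prod]
    exact Finset.prod_eq_one fun w _ => rfl
  exact ⟨x₀, hx₀_mem, hx₀_loc, hx₀_fst, hx₀_nT⟩

/-- **Idelic characters from local characters (explicit form).**  Let `K` be a number field all
of whose units have finite order, `T` a finite set of finite places and, for `w ∈ T`, continuous
characters `φ_{w,i} : 𝒪_wˣ → ℤ_p` (`i < n_w`).  With `h` the class number there are continuous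
characters `χ_{w,i} : 𝕀_K → ℤ_p`, **trivial on `Kˣ`**, such that on unit ideles
`χ_{w,i}(x) = h · φ_{w,i}(x_w)`: every idele satisfies `x^h = k · u` with `k ∈ Kˣ`, `u ∈ 𝕌_K`
(`exists_unitOrd_pow_card_classGroup_eq_zero`), unique up to a global unit, of finite order, and
`χ(x) = φ(u_w)`; continuity holds because `χ = h · φ(x_w)` on the open subgroup `𝕌_K`.  This is
Washington's map `∏_{𝔭∣p} U_𝔭 → Gal(F/H)` made explicit on the idelic side.
Ref: Washington, *Introduction to Cyclotomic Fields*, §13.1, Thm. 13.4 and its proof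
(p. 265–266); Neukirch, *Algebraic Number Theory*, Ch. VI §1 Prop. (1.3)–(1.4). [folklore] -/
theorem exists_idelicCharacters_of_localCharacters (p : ℕ) [Fact p.Prime]
    (hunits : ∀ ε : (𝓞 K)ˣ, IsOfFinOrder ε) (T : Finset (HeightOneSpectrum (𝓞 K))) (n : T → ℕ)
    (φ : ∀ w : T, Fin (n w) → ((w.1.adicCompletionIntegers K)ˣ →ₜ* Multiplicative ℤ_[p])) :
    ∃ (h : ℕ) (χ : (Σ w : T, Fin (n w)) → (GaloisRepresentations.ideleGroup K →ₜ* Multiplicative ℤ_[p])),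
      h ≠ 0 ∧ (∀ j, ∀ x ∈ GaloisRepresentations.principalIdeles K, χ j x = 1) ∧
      ∀ j (x : GaloisRepresentations.ideleGroup K) (hx : x ∈ GaloisRepresentations.unitIdeles K),
        (χ j x).toAdd = h * (φ j.1 j.2 (localUnit j.1.1 ⟨x, hx⟩)).toAdd := by
  classical
  let J := Σ w : T, Fin (n w)
  /- Step 1: the class-number decomposition `x^h = k · u`. -/
  set h : ℕ := Fintype.card (ClassGroup (𝓞 K)) with hh_def
  have hh0 : h ≠ 0 := Fintype.card_ne_zero
  let sndU : GaloisRepresentations.ideleGroup K →* (FiniteAdeleRing (𝓞 K) K)ˣ :=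
    Units.map (RingHom.snd (InfiniteAdeleRing K) (FiniteAdeleRing (𝓞 K) K)).toMonoidHom
  have hsndU : ∀ (x : GaloisRepresentations.ideleGroup K) (v : HeightOneSpectrum (𝓞 K)),
      ((sndU x : (FiniteAdeleRing (𝓞 K) K)ˣ) : FiniteAdeleRing (𝓞 K) K) v =
        (x : AdeleRing (𝓞 K) K).2 v := fun x v => rfl
  have hdec : ∀ x : GaloisRepresentations.ideleGroup K, ∃ k : Kˣ, x ^ h * (GaloisRepresentations.principalIdele K k)⁻¹ ∈ GaloisRepresentations.unitIdeles K := by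
    intro x
    obtain ⟨k, hk⟩ :=
      GaloisRepresentations.FiniteAdeleRing.exists_unitOrd_pow_card_classGroup_eq_zero (F := K) (sndU x)
    refine ⟨k, fun v => ?_⟩
    have h1 := (Automorphic.FiniteAdeleRing.unitOrd_eq_zero_iff _ v).1 (hk v)
    have h2 : sndU (x ^ h * (GaloisRepresentations.principalIdele K k)⁻¹) =
        sndU x ^ h * (FiniteAdeleRing.unitEmbedding (𝓞 K) K k)⁻¹ := by
      rw [map_mul, map_pow, map_inv, ← GaloisRepresentations.unitsMap_snd_principalIdele]
      rfl
    rw [← hh_def, ← h2, hsndU] at h1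
    exact h1
  choose kx hkx using hdec
  -- `w x = x^h · k(x)⁻¹ ∈ 𝕌`
  let wU : GaloisRepresentations.ideleGroup K → GaloisRepresentations.unitIdeles K := fun x => ⟨x ^ h * (GaloisRepresentations.principalIdele K (kx x))⁻¹, hkx x⟩
  /- Step 2: the additive functions `F j` on unit ideles. -/
  let F : J → GaloisRepresentations.unitIdeles K → ℤ_[p] := fun j u => (φ j.1 j.2 (localUnit j.1.1 u)).toAdd
  have hF_mul : ∀ j (a b : GaloisRepresentations.unitIdeles K), F j (a * b) = F j a + F j b := fun j a b => by
    simp only [F, map_mul, toAdd_mul]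
  have hF_one : ∀ j, F j 1 = 0 := fun j => by simp only [F, map_one, toAdd_one]
  have hF_pow : ∀ j (a : GaloisRepresentations.unitIdeles K) (k : ℕ), F j (a ^ k) = k • F j a := fun j a k => by
    induction k with
    | zero => rw [pow_zero, hF_one, zero_smul]
    | succ k ih => rw [pow_succ, hF_mul, ih, succ_nsmul]
  have hF_cont : ∀ j, Continuous (F j) := fun j =>
    continuous_toAdd.comp ((φ j.1 j.2).continuous.comp (continuous_localUnit j.1.1))
  have hF_finOrder : ∀ j (a : GaloisRepresentations.unitIdeles K), IsOfFinOrder a → F j a = 0 := fun j a ha => by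
    obtain ⟨k, hk, hak⟩ := ha.exists_pow_eq_one
    have h1 : k • F j a = 0 := by rw [← hF_pow, hak, hF_one]
    rw [nsmul_eq_mul, mul_eq_zero] at h1
    exact h1.resolve_left (by exact_mod_cast hk.ne')
  -- well-definedness: unit ideles differing by a principal idele have the same `F`
  have hWD : ∀ j (a b : GaloisRepresentations.unitIdeles K) (k : Kˣ), (a : GaloisRepresentations.ideleGroup K) = b * GaloisRepresentations.principalIdele K k →
      F j a = F j b := by
    intro j a b k hab
    have hkmem : GaloisRepresentations.principalIdele K k ∈ GaloisRepresentations.unitIdeles K := by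
      have : GaloisRepresentations.principalIdele K k = ((b⁻¹ * a : GaloisRepresentations.unitIdeles K) : GaloisRepresentations.ideleGroup K) := by
        rw [Subgroup.coe_mul, Subgroup.coe_inv, hab, ← mul_assoc, inv_mul_cancel, one_mul]
      rw [this]; exact (b⁻¹ * a).2
    obtain ⟨ε, hε⟩ := GaloisRepresentations.exists_units_eq_of_mem_unitIdeles hkmem
    have hfin : IsOfFinOrder (⟨GaloisRepresentations.principalIdele K k, hkmem⟩ : GaloisRepresentations.unitIdeles K) := by
      have hk : k = Units.map (algebraMap (𝓞 K) K : 𝓞 K →* K) ε := Units.ext hε.symm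
      have h1 : IsOfFinOrder (GaloisRepresentations.principalIdele K k) := by
        rw [hk]
        exact (GaloisRepresentations.principalIdele K).isOfFinOrder
          ((Units.map (algebraMap (𝓞 K) K : 𝓞 K →* K)).isOfFinOrder (hunits ε))
      obtain ⟨N, hN, hN1⟩ := h1.exists_pow_eq_one
      exact isOfFinOrder_iff_pow_eq_one.2 ⟨N, hN, Subtype.ext (by
        rw [Subgroup.coe_pow, Subgroup.coe_one]; exact hN1)⟩
    have hab' : a = b * ⟨GaloisRepresentations.principalIdele K k, hkmem⟩ := Subtype.ext (by
      rw [Subgroup.coe_mul]; exact hab)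
    rw [hab', hF_mul, hF_finOrder j _ hfin, add_zero]
  /- Step 3: the characters `χ_j(x) = F_j(w x)`. -/
  let χf : J → GaloisRepresentations.ideleGroup K → ℤ_[p] := fun j x => F j (wU x)
  have hwU_coe : ∀ x, ((wU x : GaloisRepresentations.unitIdeles K) : GaloisRepresentations.ideleGroup K) = x ^ h * (GaloisRepresentations.principalIdele K (kx x))⁻¹ :=
    fun x => rfl
  have hχf_mul : ∀ j x y, χf j (x * y) = χf j x + χf j y := fun j x y => by
    change F j (wU (x * y)) = F j (wU x) + F j (wU y)
    rw [← hF_mul]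
    refine hWD j _ _ (kx x * kx y * (kx (x * y))⁻¹) ?_
    rw [Subgroup.coe_mul, hwU_coe, hwU_coe, hwU_coe, map_mul, map_mul, map_inv, mul_pow]
    -- both sides are `x^h y^h k(xy)⁻¹`: a commutative-group identity
    apply Additive.ofMul.injective
    simp only [ofMul_mul, ofMul_inv]
    abel
  have hχf_principal : ∀ j (k : Kˣ), χf j (GaloisRepresentations.principalIdele K k) = 0 := fun j k => by
    change F j (wU (GaloisRepresentations.principalIdele K k)) = 0
    rw [← hF_one j]
    refine hWD j _ _ (k ^ h * (kx (GaloisRepresentations.principalIdele K k))⁻¹) ?_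
    rw [hwU_coe, Subgroup.coe_one, one_mul, map_mul, map_inv, map_pow]
  -- on unit ideles `χ_j(x) = h · F_j(x)`
  have hχf_unit : ∀ j (x : GaloisRepresentations.ideleGroup K) (hx : x ∈ GaloisRepresentations.unitIdeles K), χf j x = h • F j ⟨x, hx⟩ :=
    fun j x hx => by
    change F j (wU x) = h • F j ⟨x, hx⟩
    rw [← hF_pow]
    refine hWD j _ _ ((kx x)⁻¹) ?_
    rw [hwU_coe, Subgroup.coe_pow, map_inv]
  -- continuity
  have hχf_cont : ∀ j, Continuous (χf j) := fun j => by
    let χm : GaloisRepresentations.ideleGroup K →* Multiplicative ℤ_[p] :=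
      { toFun := fun x => Multiplicative.ofAdd (χf j x)
        map_one' := by
          have h1 := hχf_mul j 1 1
          rw [mul_one, left_eq_add] at h1
          rw [h1]; rfl
        map_mul' := fun x y => by rw [hχf_mul, ofAdd_add] }
    have hχm1 : ∀ x, χm x = Multiplicative.ofAdd (χf j x) := fun x => rfl
    have hχm : Continuous χm := by
      refine continuous_of_continuousAt_one χm ?_
      rw [ContinuousAt, Filter.tendsto_def]
      intro U hU
      have hG : Continuous fun u : GaloisRepresentations.unitIdeles K => Multiplicative.ofAdd ((h : ℤ_[p]) * F j u) :=
        continuous_ofAdd.comp (continuous_const.mul (hF_cont j))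
      have h1 : χm 1 = Multiplicative.ofAdd ((h : ℤ_[p]) * F j 1) := by
        rw [map_one, hF_one, mul_zero]; rfl
      have hU' : (fun u : GaloisRepresentations.unitIdeles K => Multiplicative.ofAdd ((h : ℤ_[p]) * F j u)) ⁻¹' U ∈
          𝓝 (1 : GaloisRepresentations.unitIdeles K) :=
        hG.continuousAt (by rw [← h1]; exact hU)
      obtain ⟨V, hVU, hVopen, h1V⟩ := mem_nhds_iff.1 hU'
      have hVo : IsOpen (Subtype.val '' V) := (GaloisRepresentations.isOpen_unitIdeles K).isOpenMap_subtype_val V hVopen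
      refine Filter.mem_of_superset (hVo.mem_nhds ⟨1, h1V, rfl⟩) ?_
      rintro _ ⟨u, huV, rfl⟩
      have hu := hVU huV
      rw [Set.mem_preimage] at hu ⊢
      rw [hχm1, hχf_unit j u u.2, nsmul_eq_mul]
      exact hu
    have : χf j = fun x => (χm x).toAdd := funext fun x => by rw [hχm1]; rfl
    rw [this]
    exact continuous_toAdd.comp hχm
  let χ : J → (GaloisRepresentations.ideleGroup K →ₜ* Multiplicative ℤ_[p]) := fun j =>
    { toFun := fun x => Multiplicative.ofAdd (χf j x)
      map_one' := by
        have h1 := hχf_mul j 1 1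
        rw [mul_one, left_eq_add] at h1
        rw [h1]; rfl
      map_mul' := fun x y => by rw [hχf_mul, ofAdd_add]
      continuous_toFun := continuous_ofAdd.comp (hχf_cont j) }
  have hχ_apply : ∀ j x, (χ j x).toAdd = χf j x := fun j x => rfl
  let χ : J → (GaloisRepresentations.ideleGroup K →ₜ* Multiplicative ℤ_[p]) := fun j =>
    { toFun := fun x => Multiplicative.ofAdd (χf j x)
      map_one' := by
        have h1 := hχf_mul j 1 1
        rw [mul_one, left_eq_add] at h1
        rw [h1]; rfl
      map_mul' := fun x y => by rw [hχf_mul, ofAdd_add]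
      continuous_toFun := continuous_ofAdd.comp (hχf_cont j) }
  refine ⟨h, χ, hh0, fun j x hx => ?_, fun j x hx => ?_⟩
  · obtain ⟨k, hk⟩ := hx
    apply Multiplicative.toAdd.injective
    change χf j x = (1 : Multiplicative ℤ_[p]).toAdd
    rw [toAdd_one, ← hk]
    exact hχf_principal _ k
  · change χf j x = _
    rw [hχf_unit j x hx, nsmul_eq_mul]

/-- **Characters of the idele class group from characters of the local units** (the
class-field-theoretic input to the `ℤ_p`-rank of a number field, minus class field theory).
Let `K` be a number field all of whose units have finite order (unit rank `0`: `K = ℚ` or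
imaginary quadratic) and `p` a prime.  Suppose given, for each place `v ∣ p`, `n_v` continuous
characters `𝒪_vˣ → ℤ_p` with joint image containing `p^{N_v} ℤ_p^{n_v}`, `p^{n_v} = #(𝒪_v/p)`,
and the inequality `[K:ℚ] ≤ ∑_{v∣p} n_v` (hypotheses `hloc`, `hsum`: the shape of
`Literature.NumberTheory.GaloisRepresentations.OneUnits.exists_continuousMonoidHom_forall_exists` for `A = 𝒪_v`, supplied for number
fields by the sibling `LocalOneUnitsNumberFieldProofs.lean`).  Then
there are `m ≥ [K : ℚ]` continuous characters `χ_j : 𝕀_K → ℤ_p`, **trivial on `Kˣ`**, whose joint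
image contains `p^M ℤ_p^m` (`exists_idelicCharacters_of_localCharacters` with the idele of
prescribed unit components, `exists_mem_unitIdeles_localUnit_eq`).
Ref: Washington, *Introduction to Cyclotomic Fields*, §13.1, Thm. 13.4 and its proof (p. 265–266);
Lang, *Cyclotomic Fields I and II*, Ch. 5 §5, Thm. 5.1–5.2; Neukirch, *Algebraic Number Theory*,
Ch. VI §1 Prop. (1.3)–(1.4). [folklore] -/
theorem exists_idelicCharacters (p : ℕ) [Fact p.Prime] (hunits : ∀ ε : (𝓞 K)ˣ, IsOfFinOrder ε)
    (hloc : ∀ v : HeightOneSpectrum (𝓞 K), (p : 𝓞 K) ∈ v.asIdeal →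
      ∃ (n N : ℕ) (φ : Fin n → ((v.adicCompletionIntegers K)ˣ →ₜ* Multiplicative ℤ_[p])),
        Nat.card (v.adicCompletionIntegers K ⧸
          Ideal.span {(p : v.adicCompletionIntegers K)}) = p ^ n ∧
        ∀ x : Fin n → ℤ_[p], ∃ u : (v.adicCompletionIntegers K)ˣ, ∀ i,
          (φ i u).toAdd = (p : ℤ_[p]) ^ N * x i)
    (hsum : ∀ (T : Finset (HeightOneSpectrum (𝓞 K))),
      (∀ w : HeightOneSpectrum (𝓞 K), (p : 𝓞 K) ∈ w.asIdeal → w ∈ T) →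
      ∀ n : HeightOneSpectrum (𝓞 K) → ℕ,
        (∀ w ∈ T, Nat.card (w.adicCompletionIntegers K ⧸
          Ideal.span {(p : w.adicCompletionIntegers K)}) = p ^ n w) →
        Module.finrank ℚ K ≤ ∑ w ∈ T, n w) :
    ∃ (m M : ℕ) (χ : Fin m → (GaloisRepresentations.ideleGroup K →ₜ* Multiplicative ℤ_[p])),
      Module.finrank ℚ K ≤ m ∧ (∀ j, ∀ x ∈ GaloisRepresentations.principalIdeles K, χ j x = 1) ∧
      ∀ y : Fin m → ℤ_[p], ∃ x : GaloisRepresentations.ideleGroup K, ∀ j, (χ j x).toAdd = (p : ℤ_[p]) ^ M * y j := by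
  classical
  have hp : p.Prime := Fact.out
  /- Step 0: the places above `p` and the local data. -/
  have hp0 : (p : 𝓞 K) ≠ 0 := by exact_mod_cast hp.ne_zero
  have hI : Ideal.span {(p : 𝓞 K)} ≠ 0 := by
    rw [Ne, Ideal.zero_eq_bot, Ideal.span_singleton_eq_bot]; exact hp0
  set T : Finset (HeightOneSpectrum (𝓞 K)) := (Ideal.finite_factors hI).toFinset with hT_def
  have hmemT : ∀ w : HeightOneSpectrum (𝓞 K), w ∈ T ↔ (p : 𝓞 K) ∈ w.asIdeal := fun w => by
    rw [hT_def, Set.Finite.mem_toFinset, Set.mem_setOf_eq, Ideal.dvd_span_singleton]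
  choose n N φ hcardloc hsurjloc using fun w : T => hloc w.1 ((hmemT w.1).1 w.2)
  -- total number of characters
  let n' : HeightOneSpectrum (𝓞 K) → ℕ := fun w => if hw : w ∈ T then n ⟨w, hw⟩ else 0
  set m : ℕ := ∑ w ∈ T, n' w with hm_def
  have hfinrank : Module.finrank ℚ K ≤ m :=
    hsum T (fun w hw => (hmemT w).2 hw) n' fun w hw => by
      simp only [n', dif_pos hw]; exact hcardloc ⟨w, hw⟩
  -- the index type
  let J := Σ w : T, Fin (n w)
  have hcardJ : Fintype.card J = m := by
    rw [Fintype.card_sigma, hm_def, ← Finset.sum_coe_sort T]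
    refine Finset.sum_congr rfl fun w _ => ?_
    rw [Fintype.card_fin]
    simp only [n', dif_pos w.2]
  let e : J ≃ Fin m := Fintype.equivOfCardEq (by rw [hcardJ, Fintype.card_fin])
  -- the characters
  obtain ⟨h, χ, hh0, hprinc, hunit⟩ :=
    exists_idelicCharacters_of_localCharacters (K := K) p hunits T n φ
  /- Joint surjectivity onto `p^M ℤ_p^J`, `M = a + ∑ N_w`, `h = p^a · unit`. -/
  have hhp : (h : ℤ_[p]) ≠ 0 := by exact_mod_cast hh0
  set a : ℕ := (h : ℤ_[p]).valuation with ha_def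
  set η : ℤ_[p]ˣ := PadicInt.unitCoeff hhp with hη_def
  have hh_eq : (h : ℤ_[p]) = η * (p : ℤ_[p]) ^ a := PadicInt.unitCoeff_spec hhp
  set Nmax : ℕ := ∑ w : T, N w with hNmax_def
  have hNle : ∀ w : T, N w ≤ Nmax := fun w =>
    Finset.single_le_sum (f := N) (fun _ _ => Nat.zero_le _) (Finset.mem_univ w)
  have hsurjJ : ∀ Y : J → ℤ_[p], ∃ x : GaloisRepresentations.ideleGroup K, ∀ j,
      (χ j x).toAdd = (p : ℤ_[p]) ^ (a + Nmax) * Y j := by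
    intro Y
    have hz : ∀ w : T, ∃ u : (w.1.adicCompletionIntegers K)ˣ, ∀ i,
        (φ w i u).toAdd = (p : ℤ_[p]) ^ N w *
          (((η⁻¹ : ℤ_[p]ˣ) : ℤ_[p]) * (p : ℤ_[p]) ^ (Nmax - N w) * Y ⟨w, i⟩) :=
      fun w => hsurjloc w _
    choose u hu using hz
    obtain ⟨x₀, hx₀_mem, hx₀_loc, -, -⟩ := exists_mem_unitIdeles_localUnit_eq (K := K) T u
    refine ⟨x₀, fun j => ?_⟩
    rw [hunit j x₀ hx₀_mem, hx₀_loc, hu, hh_eq]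
    obtain ⟨d, hd⟩ := Nat.exists_eq_add_of_le (hNle j.1)
    rw [hd, Nat.add_sub_cancel_left, pow_add, pow_add]
    have hηη : ((η : ℤ_[p]ˣ) : ℤ_[p]) * ((η⁻¹ : ℤ_[p]ˣ) : ℤ_[p]) = 1 := Units.mul_inv η
    linear_combination ((p : ℤ_[p]) ^ a * (p : ℤ_[p]) ^ N j.1 * (p : ℤ_[p]) ^ d * Y j) * hηη
  /- Reindex by `Fin m`. -/
  refine ⟨m, a + Nmax, fun i => χ (e.symm i), hfinrank, fun i x hx => hprinc _ x hx, fun y => ?_⟩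
  obtain ⟨x, hx⟩ := hsurjJ (y ∘ e)
  refine ⟨x, fun i => ?_⟩
  rw [hx, Function.comp_apply, Equiv.apply_symm_apply]

end Main

end Literature.NumberTheory.EllipticCurves
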